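import Summits.BirchSwinnertonDyer.BirchSwinnertonDyer.Theorems.AdditiveBranchIMCGordTwoRankZeroExact
import Summits.BirchSwinnertonDyer.BirchSwinnertonDyer.Theorems.AdditiveBranchIMCGordTwoRankOneCM
import HarnessLib

/-!
# Crux `GordTwoRankZeroOffCaseOne` (route `AdditiveBranchIMC`, items 19357 / 19244 / 19245): the residual
# input after EVERY published fact of the tree is applied — non-CM content rows only

Cell `bsd-addord`, seat `bsd-addord-k1-c2` (D-0074 row B1), gen 2; sequel of
`AdditiveBranchIMCGordTwoRankZero{Transport,Exact}` (gen 0). HONEST FRAMING: nothing here proves the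
Birch–Swinnerton-Dyer conjecture, the crux or its children; every published input is an explicit
named-fact binder of the tree; the displayed residual input is NOT in print (Skinner–Urban 2014
Thm. 3.6.1 needs the family character `χ_𝐟 = 1` and the Manin–Vishik `L_{f,ψ}` of §3.4.4 a `ψ` of
conductor prime to `p`, so the `ω^{(p−1)/2}`-branch of the good ordinary twist `E♭` is not reached;
Wan 2015 needs `p` unramified; Burungale–Skinner–Tian–Wan 2024 / Fouquet–Wan 2021 / Keller–Yin 2024
are preprints). This file closes nothing and books nothing.

WHAT IS NEW over gen 0 (`gordTwoRankZeroOffCaseOne_iff_forall_cycLowerLeadingTerm_of_facts`: the crux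
⟺ the `T = 0` lower input `CycLowerLeadingTermAt W p` on EVERY off-Case-1 rank-0 pair of cell
(G-ord, `e = 2`)): two sub-loci of those pairs are discharged from PUBLISHED facts, so the residual
input shrinks to the NON-CM CONTENT rows:

* **CM rows** (`W.HasCM`): a CM curve with `L(E,1) ≠ 0` satisfies the full BSD formula — Rubin 1991 /
  Burungale–Flach 2024 Thm. 1.1 + Cor. 2 with Cassels' isogeny invariance (tree fact
  `bsdTriple_of_hasCM_of_L_one_ne_zero`, `hCM`) — hence the lower half at EVERY prime: landed by seat
  k1-c3 as `AdditiveBranchIMCGordTwoRankOne.missingLowerBoundAt_rankZero_of_hasCM_of_burungaleFlach`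
  (imported, not restated). The CM newforms at potentially ordinary `p` are also where Kato's main
  conjecture is in print (Müller, Glasgow Math. J. 66 (2024)); the tree's road is the BSD formula itself.
* **Non-content rows** (`#Ш(E)_an` a rational of `p`-adic valuation `≤ 0`): the lower half is trivial
  (the cell's `N10.missingLowerBoundAt_of_padicValRat_le_zero`, imported).

RESULTS (all modulo the route's `PrintedFacts` / `ReadingFacts` conjuncts actually used — `hDel`,
`hGZK`, `hmod`, `hmodD` resp. `hDelG` — plus `hCM`, and `hPal` on the even branch):
* §1 `cycLowerLeadingTermAt_of_hasCM_cellGordTwo_rankZero` (on CM rows the `T = 0` input HOLDS).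
* §2 `gordTwoRankZeroOffCaseOne_iff_residual[_of_facts]`: **crux 19357 ⟺ (∀ globally minimal `W`,
  prime `p`: `r_an = 0`, `N10.CellGordTwo W p`, no Case-1 member, `¬ W.HasCM`, and `#Ш(E)_an` has
  positive `p`-adic valuation whenever rational ⟹ `CycLowerLeadingTermAt W p`)**.
* §3 the children BY NAME from the residual inputs per parity, in the Λ-adic currency of their
  informal statements (`ChiBranchLowerDivisibility[Odd]At` on non-CM content rows) and in the `T = 0`
  currency (iffs): `gordTwoRankZeroOffCaseOneEven_of_facts_of_residualDivisibility`,
  `gordTwoRankZeroOffCaseOneOdd_of_facts_of_residualDivisibilityOdd`,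
  `gordTwoRankZeroOffCaseOne{Even,Odd}_iff_residual_of_facts`.

References: Burungale–Flach, Camb. J. Math. 12 (2024) Thm. 1.1, Cor. 2 [BurungaleFlach2024]; Rubin,
Invent. Math. 103 (1991) [Rubin1991]; Milne, Arithmetic Duality Theorems, Thm. I.7.3 [MilneADT2006];
Miller, LMS J. Comput. Math. 14 (2011) Def. 1.1 [Miller2011LMS]; Delbourgo, Compositio Math. 113 (1998)
Prop. 4, Main Conjecture p. 151 [Delbourgo1998]; Skinner–Urban, Invent. Math. 195 (2014) §3.4.4,
Thm. 3.6.1, Thm. 3.6.4 [SkinnerUrban2014]; Pal, [Pal2012] Thm. 3.2; Mazur–Tate–Teitelbaum 1986 §I.14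
[MazurTateTeitelbaum1986Invent].
-/

noncomputable section

open scoped Classical

open WeierstrassCurve Literature.NumberTheory.EllipticCurves
  Literature.NumberTheory.EllipticCurves.Rank1Residual
  Literature.NumberTheory.EllipticCurves.Rank1Residual.Typed

set_option autoImplicit false
set_option linter.dupNamespace false

namespace Summit.BirchSwinnertonDyer.BirchSwinnertonDyer.Theorems.AdditiveBranchIMCGordTwoRankZeroResidual

open Summit.BirchSwinnertonDyer.Rank1Residual
open Summit.BirchSwinnertonDyer.Rank1Residual.Additive
open Summit.BirchSwinnertonDyer.BirchSwinnertonDyer.Theses.AdditiveBranchIMC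
open Summit.BirchSwinnertonDyer.BirchSwinnertonDyer.Theorems.AdditiveBranchIMCGordTwoRankZeroTransport
open Summit.BirchSwinnertonDyer.BirchSwinnertonDyer.Theorems.AdditiveBranchIMCGordTwoRankZeroExact
open Summit.BirchSwinnertonDyer.BirchSwinnertonDyer.Theorems.AdditiveBranchIMCGordTwoRankOne

variable {W : WeierstrassCurve ℚ} [W.IsElliptic] [W.IsGloballyMinimal] {p : ℕ} [hp : Fact p.Prime]

/-! ## §1 On the CM rows the crux's one input is a theorem -/

/-- **CM rows of cell (G-ord, `e = 2`), analytic rank `0`: the `T = 0` lower input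
`CycLowerLeadingTermAt W p` HOLDS** — by the CM lower half (k1-c3, Burungale–Flach) and the gen-0 exactness
`missingLowerBoundAt_iff_cycLowerLeadingTermAt_cellGordTwo` (Delbourgo 1998 Prop. 4 in both forms
`hDel` / `hDelG`, GZK, modularity). So on the CM rows the crux's one input is not an input.
[cite: BurungaleFlach2024, Thm. 1.1 and Cor. 2] [cite: Delbourgo1998, Prop. 4 (p. 144)] -/
theorem cycLowerLeadingTermAt_of_hasCM_cellGordTwo_rankZero
    (hCM : bsdTriple_of_hasCM_of_L_one_ne_zero)
    (hDel : Delbourgo1998.prop4_rankZero_pow_dvd_constantCoeff)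
    (hDelG : Delbourgo1998.prop4_rankZero_constantCoeff_eq_unit_mul_of_potGoodOrd)
    (hGZK : rank_eq_analyticRank_of_analyticRank_le_one) (hmod : hasEntireLFunction_rat)
    (hc : N10.CellGordTwo W p) (hcm : W.HasCM) (hr : W.analyticRank = 0) :
    CycLowerLeadingTermAt W p :=
  (missingLowerBoundAt_iff_cycLowerLeadingTermAt_cellGordTwo hDel hDelG hGZK hmod hc hr).mp
    (missingLowerBoundAt_rankZero_of_hasCM_of_burungaleFlach hCM hmod hGZK hcm hr)

/-! ## §2 The crux is EXACTLY the `T = 0` lower input on the non-CM content rows -/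

/-- **Lower half on one off-Case-1 pair from the residual input at that pair.** On a pair of cell
(G-ord, `e = 2`) in analytic rank `0`: if `W` has CM the lower half holds (Burungale–Flach, k1-c3's theorem); if `#Ш(E)_an` is a
rational of valuation `≤ 0` it is trivial; otherwise the displayed `T = 0` input gives it
(gen-0 transport `missingLowerBoundAt_cellGordTwo_rankZero_of_cycLowerLeadingTerm`).
[cite: BurungaleFlach2024, Thm. 1.1 and Cor. 2] [cite: Delbourgo1998, Prop. 4 (p. 144)] [cite: Miller2011LMS, Def. 1.1] -/
theorem missingLowerBoundAt_cellGordTwo_rankZero_of_residual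
    (hCM : bsdTriple_of_hasCM_of_L_one_ne_zero)
    (hDelG : Delbourgo1998.prop4_rankZero_constantCoeff_eq_unit_mul_of_potGoodOrd)
    (hGZK : rank_eq_analyticRank_of_analyticRank_le_one) (hmod : hasEntireLFunction_rat)
    (hc : N10.CellGordTwo W p) (hr : W.analyticRank = 0)
    (hLow : ¬ W.HasCM → (∀ q : ℚ, shaAn W = (q : ℂ) → 0 < padicValRat p q) →
      CycLowerLeadingTermAt W p) :
    MissingLowerBoundAt W p := by
  by_cases hcm : W.HasCM
  · exact missingLowerBoundAt_rankZero_of_hasCM_of_burungaleFlach hCM hmod hGZK hcm hr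
  by_cases hq : ∃ q : ℚ, shaAn W = (q : ℂ) ∧ padicValRat p q ≤ 0
  · obtain ⟨q, hq, hv⟩ := hq
    exact N10.missingLowerBoundAt_of_padicValRat_le_zero W p hq hv
  · push Not at hq
    exact missingLowerBoundAt_cellGordTwo_rankZero_of_cycLowerLeadingTerm hDelG hGZK hmod hc hr
      (hLow hcm hq)

/-- **Crux 19357 ⟺ the `T = 0` main-conjecture lower input on the NON-CM CONTENT rows** of cell
(G-ord, `e = 2`) in analytic rank `0` off Case 1 — i.e. on the globally minimal `W` and primes `p`
with `r_an = 0`, `N10.CellGordTwo W p`, `¬ HasCaseOneMember W p`, `¬ W.HasCM`, and `#Ш(E)_an` of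
positive `p`-adic valuation whenever it is a rational `q`. Modulo Delbourgo 1998 Prop. 4 (`hDel`,
`hDelG`), GZK (`hGZK`), modularity (`hmod`) and the CM BSD formula (`hCM`). `→`: gen-0 exactness on
every row; `←`: Burungale–Flach on the CM rows, trivial on the non-content rows, the input elsewhere. The right-hand side is NOT
in print (module docstring); the `iff` closes nothing.
[cite: Delbourgo1998, Prop. 4 (p. 144) and Main Conjecture (p. 151)] [cite: BurungaleFlach2024, Thm. 1.1 and Cor. 2]
[cite: Miller2011LMS, Def. 1.1] -/
theorem gordTwoRankZeroOffCaseOne_iff_residual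
    (hCM : bsdTriple_of_hasCM_of_L_one_ne_zero)
    (hDel : Delbourgo1998.prop4_rankZero_pow_dvd_constantCoeff)
    (hDelG : Delbourgo1998.prop4_rankZero_constantCoeff_eq_unit_mul_of_potGoodOrd)
    (hGZK : rank_eq_analyticRank_of_analyticRank_le_one) (hmod : hasEntireLFunction_rat) :
    GordTwoRankZeroOffCaseOne ↔
      ∀ (W : WeierstrassCurve ℚ) [W.IsElliptic] [W.IsGloballyMinimal] (p : ℕ) [Fact p.Prime],
        W.analyticRank = 0 → N10.CellGordTwo W p → ¬ HasCaseOneMember W p → ¬ W.HasCM →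
          (∀ q : ℚ, shaAn W = (q : ℂ) → 0 < padicValRat p q) → CycLowerLeadingTermAt W p := by
  constructor
  · intro h W _ _ p _ hr hc hno _ _
    exact (missingLowerBoundAt_iff_cycLowerLeadingTermAt_cellGordTwo hDel hDelG hGZK hmod hc hr).mp
      (h W p hr hc hno)
  · intro hLow W _ _ p _ hr hc hno
    exact missingLowerBoundAt_cellGordTwo_rankZero_of_residual hCM hDelG hGZK hmod hc hr (hLow W p hr hc hno)

/-- **The same `iff` with the route's fact conjunctions packaged** (`PrintedFacts` supplies `hDel`,
`hGZK`, `hmod`; `ReadingFacts` supplies `hDelG`; the CM fact `hCM` is displayed — it is not a conjunct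
of the route's fact items). [cite: Delbourgo1998, Prop. 4 (p. 144)] [cite: BurungaleFlach2024, Thm. 1.1 and Cor. 2] -/
theorem gordTwoRankZeroOffCaseOne_iff_residual_of_facts (hP : PrintedFacts) (hR : ReadingFacts)
    (hCM : bsdTriple_of_hasCM_of_L_one_ne_zero) :
    GordTwoRankZeroOffCaseOne ↔
      ∀ (W : WeierstrassCurve ℚ) [W.IsElliptic] [W.IsGloballyMinimal] (p : ℕ) [Fact p.Prime],
        W.analyticRank = 0 → N10.CellGordTwo W p → ¬ HasCaseOneMember W p → ¬ W.HasCM →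
          (∀ q : ℚ, shaAn W = (q : ℂ) → 0 < padicValRat p q) → CycLowerLeadingTermAt W p :=
  gordTwoRankZeroOffCaseOne_iff_residual hCM hP.2.2.2.1 hR.2.2.2.2 hP.2.2.2.2.1 hP.2.2.2.2.2.1

/-- **Crux 19357 BY NAME from the route's facts, the CM fact and the residual input** (the `←` half,
in the shape a successor lands the crux from once the input is a theorem).
[cite: Delbourgo1998, Prop. 4 (p. 144)] [cite: BurungaleFlach2024, Thm. 1.1 and Cor. 2] -/
theorem gordTwoRankZeroOffCaseOne_of_facts_of_residual (hP : PrintedFacts) (hR : ReadingFacts)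
    (hCM : bsdTriple_of_hasCM_of_L_one_ne_zero)
    (hLow : ∀ (W : WeierstrassCurve ℚ) [W.IsElliptic] [W.IsGloballyMinimal] (p : ℕ) [Fact p.Prime],
      W.analyticRank = 0 → N10.CellGordTwo W p → ¬ HasCaseOneMember W p → ¬ W.HasCM →
        (∀ q : ℚ, shaAn W = (q : ℂ) → 0 < padicValRat p q) → CycLowerLeadingTermAt W p) :
    GordTwoRankZeroOffCaseOne :=
  (gordTwoRankZeroOffCaseOne_iff_residual_of_facts hP hR hCM).mpr hLow

/-! ## §3 The children (items 19244 / 19245) from the residual inputs per parity -/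

/-- **Child `GordTwoRankZeroOffCaseOneEven` (item 19244, `p ≡ 1 (mod 4)`) ⟺ the `T = 0` input on its
non-CM content rows**, modulo `hDel hDelG hGZK hmod hCM`. [cite: Delbourgo1998, Prop. 4 (p. 144)]
[cite: BurungaleFlach2024, Thm. 1.1 and Cor. 2] [cite: Miller2011LMS, Def. 1.1] -/
theorem gordTwoRankZeroOffCaseOneEven_iff_residual
    (hCM : bsdTriple_of_hasCM_of_L_one_ne_zero)
    (hDel : Delbourgo1998.prop4_rankZero_pow_dvd_constantCoeff)
    (hDelG : Delbourgo1998.prop4_rankZero_constantCoeff_eq_unit_mul_of_potGoodOrd)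
    (hGZK : rank_eq_analyticRank_of_analyticRank_le_one) (hmod : hasEntireLFunction_rat) :
    GordTwoRankZeroOffCaseOneEven ↔
      ∀ (W : WeierstrassCurve ℚ) [W.IsElliptic] [W.IsGloballyMinimal] (p : ℕ) [Fact p.Prime],
        W.analyticRank = 0 → N10.CellGordTwo W p → ¬ HasCaseOneMember W p → p % 4 = 1 → ¬ W.HasCM →
          (∀ q : ℚ, shaAn W = (q : ℂ) → 0 < padicValRat p q) → CycLowerLeadingTermAt W p := by
  constructor
  · intro h W _ _ p _ hr hc hno h1 _ _
    exact (missingLowerBoundAt_iff_cycLowerLeadingTermAt_cellGordTwo hDel hDelG hGZK hmod hc hr).mp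
      (h W p hr hc hno h1)
  · intro hLow W _ _ p _ hr hc hno h1
    exact missingLowerBoundAt_cellGordTwo_rankZero_of_residual hCM hDelG hGZK hmod hc hr
      (hLow W p hr hc hno h1)

/-- **Child `GordTwoRankZeroOffCaseOneOdd` (item 19245, `p ≡ 3 (mod 4)`, `p = 3` included) ⟺ the
`T = 0` input on its non-CM content rows**, modulo `hDel hDelG hGZK hmod hCM`.
[cite: Delbourgo1998, Prop. 4 (p. 144)] [cite: BurungaleFlach2024, Thm. 1.1 and Cor. 2] [cite: Miller2011LMS, Def. 1.1] -/
theorem gordTwoRankZeroOffCaseOneOdd_iff_residual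
    (hCM : bsdTriple_of_hasCM_of_L_one_ne_zero)
    (hDel : Delbourgo1998.prop4_rankZero_pow_dvd_constantCoeff)
    (hDelG : Delbourgo1998.prop4_rankZero_constantCoeff_eq_unit_mul_of_potGoodOrd)
    (hGZK : rank_eq_analyticRank_of_analyticRank_le_one) (hmod : hasEntireLFunction_rat) :
    GordTwoRankZeroOffCaseOneOdd ↔
      ∀ (W : WeierstrassCurve ℚ) [W.IsElliptic] [W.IsGloballyMinimal] (p : ℕ) [Fact p.Prime],
        W.analyticRank = 0 → N10.CellGordTwo W p → ¬ HasCaseOneMember W p → p % 4 = 3 → ¬ W.HasCM →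
          (∀ q : ℚ, shaAn W = (q : ℂ) → 0 < padicValRat p q) → CycLowerLeadingTermAt W p := by
  constructor
  · intro h W _ _ p _ hr hc hno h3 _ _
    exact (missingLowerBoundAt_iff_cycLowerLeadingTermAt_cellGordTwo hDel hDelG hGZK hmod hc hr).mp
      (h W p hr hc hno h3)
  · intro hLow W _ _ p _ hr hc hno h3
    exact missingLowerBoundAt_cellGordTwo_rankZero_of_residual hCM hDelG hGZK hmod hc hr
      (hLow W p hr hc hno h3)

/-- **The two children's `iff`s with the route's fact conjunctions packaged.**
[cite: Delbourgo1998, Prop. 4 (p. 144)] [cite: BurungaleFlach2024, Thm. 1.1 and Cor. 2] -/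
theorem gordTwoRankZeroOffCaseOneEven_iff_residual_of_facts (hP : PrintedFacts) (hR : ReadingFacts)
    (hCM : bsdTriple_of_hasCM_of_L_one_ne_zero) :
    GordTwoRankZeroOffCaseOneEven ↔
      ∀ (W : WeierstrassCurve ℚ) [W.IsElliptic] [W.IsGloballyMinimal] (p : ℕ) [Fact p.Prime],
        W.analyticRank = 0 → N10.CellGordTwo W p → ¬ HasCaseOneMember W p → p % 4 = 1 → ¬ W.HasCM →
          (∀ q : ℚ, shaAn W = (q : ℂ) → 0 < padicValRat p q) → CycLowerLeadingTermAt W p :=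
  gordTwoRankZeroOffCaseOneEven_iff_residual hCM hP.2.2.2.1 hR.2.2.2.2 hP.2.2.2.2.1 hP.2.2.2.2.2.1

/-- See `gordTwoRankZeroOffCaseOneEven_iff_residual_of_facts`; odd twin.
[cite: Delbourgo1998, Prop. 4 (p. 144)] [cite: BurungaleFlach2024, Thm. 1.1 and Cor. 2] -/
theorem gordTwoRankZeroOffCaseOneOdd_iff_residual_of_facts (hP : PrintedFacts) (hR : ReadingFacts)
    (hCM : bsdTriple_of_hasCM_of_L_one_ne_zero) :
    GordTwoRankZeroOffCaseOneOdd ↔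
      ∀ (W : WeierstrassCurve ℚ) [W.IsElliptic] [W.IsGloballyMinimal] (p : ℕ) [Fact p.Prime],
        W.analyticRank = 0 → N10.CellGordTwo W p → ¬ HasCaseOneMember W p → p % 4 = 3 → ¬ W.HasCM →
          (∀ q : ℚ, shaAn W = (q : ℂ) → 0 < padicValRat p q) → CycLowerLeadingTermAt W p :=
  gordTwoRankZeroOffCaseOneOdd_iff_residual hCM hP.2.2.2.1 hR.2.2.2.2 hP.2.2.2.2.1 hP.2.2.2.2.2.1

/-- **Child `GordTwoRankZeroOffCaseOneEven` BY NAME from the route's facts, the CM fact, Pal's period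
theorem and the Λ-ADIC even-branch input `ChiBranchLowerDivisibilityAt` on its NON-CM CONTENT rows**
(the item's informal statement names this input; Λ-adic ⟹ `T = 0` on (G-ord) by the branch constant
term, gen-0 `missingLowerBoundAt_cellGordTwo_rankZero_of_chiBranchLowerDivisibility`). CONDITIONAL on the
displayed input (not in print); closes nothing. [cite: SkinnerUrban2014, Thm. 3.6.4 (p. 43) (shape of the input)]
[cite: Pal2012, Thm. 3.2] [cite: MazurTateTeitelbaum1986Invent, §I.14] [cite: BurungaleFlach2024, Thm. 1.1 and Cor. 2] -/
theorem gordTwoRankZeroOffCaseOneEven_of_facts_of_residualDivisibility (hP : PrintedFacts)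
    (hR : ReadingFacts) (hCM : bsdTriple_of_hasCM_of_L_one_ne_zero)
    (hPal : Pal2012.thm32_sqrt_mul_realPeriodRat_twist_eq_of_prime_one_mod_four)
    (hΛ : ∀ (W : WeierstrassCurve ℚ) [W.IsElliptic] [W.IsGloballyMinimal] (p : ℕ) [Fact p.Prime],
      W.analyticRank = 0 → N10.CellGordTwo W p → ¬ HasCaseOneMember W p → p % 4 = 1 → ¬ W.HasCM →
        (∀ q : ℚ, shaAn W = (q : ℂ) → 0 < padicValRat p q) → ChiBranchLowerDivisibilityAt W p) :
    GordTwoRankZeroOffCaseOneEven := by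
  obtain ⟨-, -, -, -, hGZK, hmod, hmodD, -⟩ := hP
  obtain ⟨-, -, -, -, hDelG⟩ := hR
  intro W _ _ p _ hr hc hno h1
  by_cases hcm : W.HasCM
  · exact missingLowerBoundAt_rankZero_of_hasCM_of_burungaleFlach hCM hmod hGZK hcm hr
  by_cases hq : ∃ q : ℚ, shaAn W = (q : ℂ) ∧ padicValRat p q ≤ 0
  · obtain ⟨q, hq, hv⟩ := hq
    exact N10.missingLowerBoundAt_of_padicValRat_le_zero W p hq hv
  · push Not at hq
    exact missingLowerBoundAt_cellGordTwo_rankZero_of_chiBranchLowerDivisibility hDelG hPal hGZK hmod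
      hmodD hc h1 hr (hΛ W p hr hc hno h1 hcm hq)

/-- **Child `GordTwoRankZeroOffCaseOneOdd` BY NAME from the route's facts, the CM fact and the Λ-ADIC
odd-branch input `ChiBranchLowerDivisibilityOddAt` on its NON-CM CONTENT rows** (minus symbols; no Pal
input: the odd Birch–Pal period identity is a tree theorem; gen-0
`missingLowerBoundAt_cellGordTwo_rankZero_of_chiBranchLowerDivisibilityOdd`). CONDITIONAL on the
displayed input (not in print); closes nothing. [cite: SkinnerUrban2014, Thm. 3.6.4 (p. 43) (shape of the input)]
[cite: MazurTateTeitelbaum1986Invent, §I.14] [cite: BurungaleFlach2024, Thm. 1.1 and Cor. 2] -/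
theorem gordTwoRankZeroOffCaseOneOdd_of_facts_of_residualDivisibilityOdd (hP : PrintedFacts)
    (hR : ReadingFacts) (hCM : bsdTriple_of_hasCM_of_L_one_ne_zero)
    (hΛ : ∀ (W : WeierstrassCurve ℚ) [W.IsElliptic] [W.IsGloballyMinimal] (p : ℕ) [Fact p.Prime],
      W.analyticRank = 0 → N10.CellGordTwo W p → ¬ HasCaseOneMember W p → p % 4 = 3 → ¬ W.HasCM →
        (∀ q : ℚ, shaAn W = (q : ℂ) → 0 < padicValRat p q) → ChiBranchLowerDivisibilityOddAt W p) :
    GordTwoRankZeroOffCaseOneOdd := by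
  obtain ⟨-, -, -, -, hGZK, hmod, hmodD, -⟩ := hP
  obtain ⟨-, -, -, -, hDelG⟩ := hR
  intro W _ _ p _ hr hc hno h3
  by_cases hcm : W.HasCM
  · exact missingLowerBoundAt_rankZero_of_hasCM_of_burungaleFlach hCM hmod hGZK hcm hr
  by_cases hq : ∃ q : ℚ, shaAn W = (q : ℂ) ∧ padicValRat p q ≤ 0
  · obtain ⟨q, hq, hv⟩ := hq
    exact N10.missingLowerBoundAt_of_padicValRat_le_zero W p hq hv
  · push Not at hq
    exact missingLowerBoundAt_cellGordTwo_rankZero_of_chiBranchLowerDivisibilityOdd hDelG hGZK hmod hmodD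
      hc h3 hr (hΛ W p hr hc hno h3 hcm hq)

/-- **Parent 19357 BY NAME from the two parity-split Λ-adic residual inputs** (through the landed glue
`additiveBranchIMC_gordTwoRankZeroOffCaseOneGlue_proof` is not needed: the split is by `p % 4` inside
the proof). CONDITIONAL on the displayed inputs; closes nothing.
[cite: SkinnerUrban2014, Thm. 3.6.4 (p. 43) (shape of the inputs)] [cite: Pal2012, Thm. 3.2]
[cite: BurungaleFlach2024, Thm. 1.1 and Cor. 2] -/
theorem gordTwoRankZeroOffCaseOne_of_facts_of_residualDivisibility (hP : PrintedFacts)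
    (hR : ReadingFacts) (hCM : bsdTriple_of_hasCM_of_L_one_ne_zero)
    (hPal : Pal2012.thm32_sqrt_mul_realPeriodRat_twist_eq_of_prime_one_mod_four)
    (hΛEven : ∀ (W : WeierstrassCurve ℚ) [W.IsElliptic] [W.IsGloballyMinimal] (p : ℕ) [Fact p.Prime],
      W.analyticRank = 0 → N10.CellGordTwo W p → ¬ HasCaseOneMember W p → p % 4 = 1 → ¬ W.HasCM →
        (∀ q : ℚ, shaAn W = (q : ℂ) → 0 < padicValRat p q) → ChiBranchLowerDivisibilityAt W p)
    (hΛOdd : ∀ (W : WeierstrassCurve ℚ) [W.IsElliptic] [W.IsGloballyMinimal] (p : ℕ) [Fact p.Prime],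
      W.analyticRank = 0 → N10.CellGordTwo W p → ¬ HasCaseOneMember W p → p % 4 = 3 → ¬ W.HasCM →
        (∀ q : ℚ, shaAn W = (q : ℂ) → 0 < padicValRat p q) → ChiBranchLowerDivisibilityOddAt W p) :
    GordTwoRankZeroOffCaseOne := by
  intro W _ _ p _ hr hc hno
  have h4 : p % 4 = 1 ∨ p % 4 = 3 := by
    have := Nat.odd_iff.mp ((Fact.out : p.Prime).odd_of_ne_two hc.1); omega
  rcases h4 with h1 | h3
  · exact gordTwoRankZeroOffCaseOneEven_of_facts_of_residualDivisibility hP hR hCM hPal hΛEven W p hr hc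
      hno h1
  · exact gordTwoRankZeroOffCaseOneOdd_of_facts_of_residualDivisibilityOdd hP hR hCM hΛOdd W p hr hc hno h3

end Summit.BirchSwinnertonDyer.BirchSwinnertonDyer.Theorems.AdditiveBranchIMCGordTwoRankZeroResidual

end
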